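import Literature.Computability.AlgebraicComplexity.Kron444HullMain
import Literature.Computability.AlgebraicComplexity.Kron444Facets2
import Literature.Computability.AlgebraicComplexity.Kron444VertexOccurrence
import Literature.Computability.AlgebraicComplexity.UnitTensorMomentPolytopeRays
import Mathlib.Analysis.Convex.Combination
import Mathlib.Logic.Equiv.Fin.Basic
import HarnessLib

/-!
# `Δ(⟨4⟩) = Kron(4,4,4)`: discharge of `vandenBergEtAl2025_unitTensor_four_polytope_maximal`

Topic `Computability/AlgebraicComplexity`; proofs file (theorems only) of the named fact
`vandenBergEtAl2025_unitTensor_four_polytope_maximal` (`UnitTensorMomentPolytope.lean`): every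
partition triple occurring in a tensor power of a tensor of format `≤ 4 × 4 × 4` has a positive
multiple occurring in a power of the unit tensor `⟨4⟩` — "`Δ(⟨4⟩)` equals `Kron₄₄₄`, as can be seen
using the tensor scaling algorithm and knowledge of the vertices of `Kron₄₄₄`, which were
determined in [Vergne–Walter]" [vandenBergChristandlLysikovNieuwboerWalterZuiddam2025, §1 after
Cor. 1.5]; [vandenBergEtAl2025ComputingMomentPolytopes, §6.2 ("If we let `p` range over the vertices
of `P` and … prove `p ∈ Δ(T)` for all `p`, we obtain `P ⊆ Δ(T)` by convexity"), §6.5]. The proof is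
the tree's `vandenBergEtAl2025_unitTensor_four_polytope_maximal_of_rays`
(`UnitTensorMomentPolytopeRays.lean`) applied to the `328` vertex rays of the Vergne–Walter list,
whose two hypotheses are supplied by:

* **`KroneckerConeGenerators`** (`Kron444Hull.hgen_core` below): a triple `λ ⊢ n` with positive
  Kronecker coefficient and `≤ 4` parts occurs for some `s ∈ ℂ⁴⊗ℂ⁴⊗ℂ⁴`
  (`exists_occurs_of_kroneckerCoeff_pos`, `KroneckerPolytopeTangentMap.lean`), hence satisfies the
  `270` Vergne–Walter facet inequalities (`Kron444.facets_valid`, `Kron444Facets{,2}.lean` —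
  VW Prop. 3.13 with explicit tangent-map certificates), hence `λ/n` lies in the convex hull of the
  `328` vertices (`Kron444Hull.mem_convexHull_vertices`, the kernel-checked V-description
  certificate of `Kron444HullCheck/Checks*/Hull/HullMain.lean`), and clearing denominators writes a
  multiple of `λ` as an `ℕ`-combination of the rays;
* **`UnitTensorHitsGenerators`** (`Kron444Hull.hocc`, `Kron444VertexOccurrence.lean`): each ray
  occurs in a power of `⟨4⟩`, by the kernel-evaluated highest-weight pairing certificates of
  `HighestWeightPairingCertificates.lean` / `Kron444VertexCertificates.lean` (in place of the
  sources' tensor-scaling certificates) and the `S₃`-symmetry of `S(⟨4⟩)`.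

## References

* [vandenBergChristandlLysikovNieuwboerWalterZuiddam2025] M. van den Berg, M. Christandl, V. Lysikov,
  H. Nieuwboer, M. Walter, J. Zuiddam, *The moment polytope of matrix multiplication is not
  maximal*, arXiv:2503.22633 (2025), §1 (after Cor. 1.5).
* [vandenBergEtAl2025ComputingMomentPolytopes] same authors, *Computing moment polytopes — with a
  focus on tensors, entanglement and matrix multiplication*, arXiv:2510.08336 (2025), §6.2, §6.5.
* [VergneWalter2014] M. Vergne, M. Walter, *Inequalities for moment cones of finite-dimensional
  representations*, arXiv:1410.8144 = J. Symplectic Geom. 15 (2017), Prop. 3.13, §6.2, Tables.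
* [BurgisserIkenmeyer2011] P. Bürgisser, C. Ikenmeyer, *Geometric complexity theory and tensor
  rank*, STOC 2011 = arXiv:1011.1350, §4, Lemma 10.18–10.19.
* [Ziegler1995] G. M. Ziegler, *Lectures on Polytopes*, GTM 152, Lecture 1 (Thm. 1.1), §8.1.
-/

noncomputable section

open scoped BigOperators Matrix

namespace Literature.Computability.AlgebraicComplexity

/-! ## The generating layer: every Kronecker triple is a scaled ℕ-combination of the vertex rays -/

section Rays

open Literature.NumberTheory.DiophantineGeometry (Weight kroneckerCoeff)

namespace Kron444Hull

/-- Field `i ≤ 12` of hull vertex `r` as an integer: numerators (`i < 12`) and denominator (`i = 12`).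
[cite: VergneWalter2014, §6.2 and Tables] -/
theorem rowVert_getD (r i : ℕ) (hi : i < 13) : (rowVert r).getD i 0 = (vF r i : ℤ) := by
  rw [rowVert, List.getD_eq_getElem?_getD, List.getElem?_map, List.getElem?_range hi]
  simp only [Option.map_some, Option.getD_some, vF, ← Nat.shiftRight_add]
  congr 3
  ring

/-- The coordinates of hull vertex `r`: `vq r p = vF r p / vF r 12`. [folklore] -/
theorem vq_apply (r : ℕ) (p : Fin 12) : vq r p = (vF r p : ℚ) / (vF r 12 : ℚ) := by
  simp only [vq, qent, rowVert_getD r p (by omega), rowVert_getD r 12 (by norm_num), Int.cast_natCast]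

/-- The entries of facet row `k`: `(rowAz k)[i] = facetEntry k i`. [cite: VergneWalter2014, §6.2 and Tables] -/
theorem rowAz_getD (k : Fin 270) (i : ℕ) (hi : i < 13) :
    (rowAz k).getD i 0 = Kron444.facetEntry k i := by
  rw [rowAz, if_pos k.2, List.getD_eq_getElem?_getD, List.getElem?_map, List.getElem?_range hi]
  simp only [Option.map_some, Option.getD_some, Kron444.facetEntry, ← Nat.shiftRight_add]
  congr 4
  ring

/-- Sums over `Fin 12` as double sums over blocks. [folklore] -/
theorem sum_fin12 (f : Fin 12 → ℚ) :
    ∑ p : Fin 12, f p = ∑ j : Fin 3, ∑ i : Fin 4, f (finProdFinEquiv (j, i)) := by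
  rw [← Equiv.sum_comp (finProdFinEquiv (m := 3) (n := 4)) f, Fintype.sum_prod_type]

/-- The value of the block index `(j, i) ↦ i + 4 j`. [folklore] -/
theorem val_finProdFinEquiv (j : Fin 3) (i : Fin 4) :
    ((finProdFinEquiv (j, i) : Fin 12) : ℕ) = i + 4 * j := rfl

/-- **The generating layer from the verified V-description.** Assume (i) every `x ∈ ℚ¹²` with the
three blocks summing to `1` and satisfying the `270` facet inequalities is in the convex hull of the
hull vertices, (ii) the `270` inequalities hold for every occurring triple, (iii) the denominators
of the hull vertices are positive. Then every partition triple `λ ⊢ n`, `n > 0`, with positive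
Kronecker coefficient and at most `4` parts has a positive multiple whose weight triple is an
`ℕ`-combination of the rays `rayW r = rayK r · W_r` (`Kron444VertexOccurrence.lean`): `λ/n` satisfies the
inequalities (the triple occurs for some `s ∈ ℂ⁴⊗ℂ⁴⊗ℂ⁴`, `exists_occurs_of_kroneckerCoeff_pos`),
hence `λ/n = ∑ c_r v_r`, and clearing denominators gives the claim.
[cite: vandenBergEtAl2025ComputingMomentPolytopes, §6.2] [cite: BurgisserIkenmeyer2011, Lemma 10.18–10.19] -/
theorem hgen_core
    (hV : ∀ x : Fin 12 → ℚ, (∀ t, t < 3 → hE t ⬝ᵥ hx x = 0) → (∀ k, k < 270 → 0 ≤ gq k x) →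
      x ∈ convexHull ℚ Vset)
    (hF : ∀ {n : ℕ} {lam : Fin 3 → Nat.Partition n} {s : Fin 4 → Fin 4 → Fin 4 → ℂ},
      isotypicSum₁ (lam 0) (isotypicSum₂ (lam 1) (isotypicSum₃ (lam 2) (kroneckerPow s n))) ≠ 0 →
      ∀ k : Fin 270, 0 ≤ hPairing (Kron444.rowA k) (Kron444.rowB k) (Kron444.rowC k) (Kron444.rowZ k) lam)
    (hEx : ∀ {n : ℕ} {lam : Fin 3 → Nat.Partition n}, (∀ j, (lam j).parts.card ≤ 4) →
      0 < kroneckerCoeff ℂ (lam 0) (lam 1) (lam 2) →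
      ∃ s : Fin 4 → Fin 4 → Fin 4 → ℂ,
        isotypicSum₁ (lam 0) (isotypicSum₂ (lam 1) (isotypicSum₃ (lam 2) (kroneckerPow s n))) ≠ 0)
    (hden : ∀ r, r < nV → 0 < vF r 12)
    (hk : ∀ r, r < nV → 0 < rayK r)
    {n : ℕ} (lam : Fin 3 → Nat.Partition n) (hn : 0 < n)
    (hg : 0 < kroneckerCoeff ℂ (lam 0) (lam 1) (lam 2)) (hcard : ∀ j, (lam j).parts.card ≤ 4) :
    ∃ (M : ℕ) (a : ℕ → ℕ), 0 < M ∧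
      ∀ j, M • Weight.ofPartition 4 (lam j) = (∑ r ∈ Finset.range nV, a r • rayW r) j := by
  classical
  -- (1) the triple occurs for some `s`, so the facet inequalities hold
  obtain ⟨s, hs⟩ := hEx hcard hg
  have hineq := hF hs
  -- (2) the normalised point `x = λ / n`
  set L : Fin 3 → Fin 4 → ℤ := fun j i => Weight.ofPartition 4 (lam j) i with hL
  set x : Fin 12 → ℚ := fun p => (L ((finProdFinEquiv (m := 3) (n := 4)).symm p).1 ((finProdFinEquiv (m := 3) (n := 4)).symm p).2 : ℚ) / n with hx_def
  have hnq : (n : ℚ) ≠ 0 := by exact_mod_cast hn.ne'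
  have hxv : ∀ (j : Fin 3) (i : Fin 4), x (finProdFinEquiv (j, i)) = (L j i : ℚ) / n := by
    intro j i; simp only [hx_def, Equiv.symm_apply_apply]
  have hnx : ∀ (j : Fin 3) (i : Fin 4), (n : ℚ) * x (finProdFinEquiv (j, i)) = L j i := by
    intro j i; rw [hxv]; field_simp
  have hsize : ∀ j, ∑ i : Fin 4, (L j i : ℚ) = n := by
    intro j
    have := Weight.size_ofPartition_holds (N := 4) (hcard j)
    unfold Weight.size at this
    exact_mod_cast this
  have hxE : ∀ t, t < 3 → hE t ⬝ᵥ hx x = 0 := by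
    intro t ht
    rw [hE_dot_hx, sum_fin12, sub_eq_zero]
    have hblock : ∀ j : Fin 3, ∑ i : Fin 4, (if ((finProdFinEquiv (j, i) : Fin 12) : ℕ) / 4 = t then x (finProdFinEquiv (j, i)) else 0) =
        if j = ⟨t, ht⟩ then 1 else 0 := by
      intro j
      have hdiv : ∀ i : Fin 4, (((finProdFinEquiv (j, i) : Fin 12) : ℕ) / 4 = t) ↔ j = ⟨t, ht⟩ := by
        intro i
        rw [val_finProdFinEquiv, Fin.ext_iff]
        have := i.2
        simp only
        omega
      simp only [hdiv]
      split_ifs with hj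
      · simp only [hxv, ← Finset.sum_div, hsize j, div_self hnq]
      · simp
    simp only [hblock, Finset.sum_ite_eq', Finset.mem_univ, if_true]
  have hxF : ∀ kk, kk < 270 → 0 ≤ gq kk x := by
    intro kk hkk
    have hP := hineq ⟨kk, hkk⟩
    have ha : ∀ (j : Fin 3) (i : Fin 4), aq kk (finProdFinEquiv (j, i)) = (Kron444.facetEntry ⟨kk, hkk⟩ (i + 4 * j) : ℚ) := by
      intro j i
      simp only [aq, qent]
      rw [val_finProdFinEquiv, rowAz_getD ⟨kk, hkk⟩ _ (by have := i.2; have := j.2; omega)]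
    have hz : qent (rowAz kk) 12 = (Kron444.facetEntry ⟨kk, hkk⟩ 12 : ℚ) := by
      simp only [qent, rowAz_getD ⟨kk, hkk⟩ 12 (by norm_num)]
    have eq : (n : ℚ) * gq kk x = (hPairing (Kron444.rowA ⟨kk, hkk⟩) (Kron444.rowB ⟨kk, hkk⟩)
        (Kron444.rowC ⟨kk, hkk⟩) (Kron444.rowZ ⟨kk, hkk⟩) lam : ℚ) := by
      calc (n : ℚ) * gq kk x = ∑ p, aq kk p * ((n : ℚ) * x p) + (n : ℚ) * qent (rowAz kk) 12 := by
            rw [gq_eq, dotProduct, mul_add, Finset.mul_sum]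
            congr 1
            exact Finset.sum_congr rfl fun p _ => by ring
        _ = ∑ j : Fin 3, ∑ i : Fin 4, (Kron444.facetEntry ⟨kk, hkk⟩ (i + 4 * j) : ℚ) * L j i +
              (n : ℚ) * Kron444.facetEntry ⟨kk, hkk⟩ 12 := by
            rw [sum_fin12, hz]
            simp only [ha, hnx]
        _ = _ := by
            rw [Fin.sum_univ_three, hPairing]
            push_cast
            simp only [Kron444.rowA, Kron444.rowB, Kron444.rowC, Kron444.rowZ, hL, Fin.val_zero,
              Fin.val_one, Fin.val_two, mul_zero, add_zero, mul_one]
            have e8 : ∀ i : Fin 4, (i : ℕ) + 4 * 2 = 8 + i := fun i => by ring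
            have e4 : ∀ i : Fin 4, (i : ℕ) + 4 = 4 + i := fun i => by ring
            simp only [e8, e4]
            ring
    have h0 : 0 ≤ (n : ℚ) * gq kk x := by rw [eq]; exact_mod_cast hP
    by_contra hneg
    push Not at hneg
    have : (n : ℚ) * gq kk x < 0 := mul_neg_of_pos_of_neg (by exact_mod_cast hn) hneg
    linarith
  -- (3) the point lies in the convex hull of the vertices
  have hxV := hV x hxE hxF
  obtain ⟨ι, _inst, w, z, hw0, hw1, hz, hzx⟩ := mem_convexHull_iff_exists_fintype.1 hxV
  choose r hr hzr using hz
  -- (4) rational coefficients on the rays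
  set q : ι → ℚ := fun i => (n : ℚ) * w i / ((vF (r i) 12 : ℚ) * (rayK (r i) : ℚ)) with hq
  have hq0 : ∀ i, 0 ≤ q i := fun i => by
    rw [hq]; exact div_nonneg (mul_nonneg (by positivity) (hw0 i)) (by positivity)
  have key : ∀ (j : Fin 3) (l : Fin 4), (L j l : ℚ) = ∑ i, q i * (rayW (r i) j l : ℚ) := by
    intro j l
    have hxp : x (finProdFinEquiv (j, l)) = ∑ i, w i * vq (r i) (finProdFinEquiv (j, l)) := by
      have := congrFun hzx (finProdFinEquiv (j, l))
      simp only [Finset.sum_apply, Pi.smul_apply, smul_eq_mul] at this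
      rw [← this]
      exact Finset.sum_congr rfl fun i _ => by rw [hzr i]
    have : (L j l : ℚ) = n * ∑ i, w i * vq (r i) (finProdFinEquiv (j, l)) := by rw [← hxp, hnx j l]
    rw [this, Finset.mul_sum]
    refine Finset.sum_congr rfl fun i _ => ?_
    have hd : (vF (r i) 12 : ℚ) ≠ 0 := by exact_mod_cast (hden _ (hr i)).ne'
    have hkq : (rayK (r i) : ℚ) ≠ 0 := by exact_mod_cast (hk _ (hr i)).ne'
    rw [vq_apply, rayW, hq, val_finProdFinEquiv]
    push_cast
    field_simp
  -- (5) clear denominators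
  set M : ℕ := ∏ i, (q i).den with hM
  have hMpos : 0 < M := Finset.prod_pos fun i _ => (q i).den_pos
  set aN : ι → ℕ := fun i => (∏ i' ∈ Finset.univ.erase i, (q i').den) * (q i).num.toNat with haN_def
  have haN : ∀ i, (aN i : ℚ) = (M : ℚ) * q i := by
    intro i
    have hnum : (((q i).num.toNat : ℤ) : ℚ) = ((q i).num : ℚ) := by
      rw [Int.toNat_of_nonneg (Rat.num_nonneg.2 (hq0 i))]
    have hnum' : ((q i).num.toNat : ℚ) = (q i).den * q i := by
      rw [mul_comm, Rat.mul_den_eq_num]; exact_mod_cast hnum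
    rw [haN_def, hM]
    push_cast
    rw [hnum', ← Finset.mul_prod_erase Finset.univ (fun i' => ((q i').den : ℚ)) (Finset.mem_univ i)]
    ring
  set a : ℕ → ℕ := fun rr => ∑ i ∈ Finset.univ.filter (fun i => r i = rr), aN i with ha_def
  refine ⟨M, a, hMpos, fun j => ?_⟩
  funext l
  apply Int.cast_injective (α := ℚ)
  have lhs : ((M • Weight.ofPartition 4 (lam j)) l : ℤ) = M * L j l := by
    simp only [Pi.smul_apply, nsmul_eq_mul, hL]
  have rhs : ((∑ rr ∈ Finset.range nV, a rr • rayW rr) j l : ℤ) =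
      ∑ rr ∈ Finset.range nV, (a rr : ℤ) * rayW rr j l := by
    rw [Finset.sum_apply, Finset.sum_apply]
    refine Finset.sum_congr rfl fun rr _ => ?_
    rw [Pi.smul_apply, Pi.smul_apply, nsmul_eq_mul]
  rw [lhs, rhs]
  push_cast
  rw [key j l, Finset.mul_sum,
    ← Finset.sum_fiberwise_of_maps_to (s := Finset.univ) (t := Finset.range nV) (g := r)
      (fun i _ => Finset.mem_range.2 (hr i))]
  refine Finset.sum_congr rfl fun rr _ => ?_
  rw [ha_def]
  push_cast
  rw [Finset.sum_mul]
  refine Finset.sum_congr rfl fun i hi => ?_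
  rw [(Finset.mem_filter.1 hi).2, haN]
  ring

end Kron444Hull

end Rays

/-! ## The named fact -/

open Literature.NumberTheory.DiophantineGeometry (Weight kroneckerCoeff) in
/-- **`Δ(⟨4⟩) = Kron(4,4,4)`** — discharge of the named fact
`vandenBergEtAl2025_unitTensor_four_polytope_maximal`: for every tensor `s ∈ ℂ^ι ⊗ ℂ^κ ⊗ ℂ^μ` with
`|ι|, |κ|, |μ| ≤ 4`, every `n > 0` and every partition triple `λ ⊢ n` whose triple isotypic sum does
not annihilate `s^{⊗n}`, some multiple `k·λ`, `k > 0`, has non-zero triple isotypic sum on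
`⟨4⟩^{⊗kn}`. Proof: `…_of_rays` with the `328` Vergne–Walter vertex rays; generation by the verified
V-description of `Kron(4,4,4)` and the proved facet inequalities (`Kron444Hull.hgen_core`),
occurrence of the rays by the kernel-checked highest-weight pairing certificates
(`Kron444Hull.hocc`).
[cite: vandenBergChristandlLysikovNieuwboerWalterZuiddam2025, §1 after Cor. 1.5]
[cite: vandenBergEtAl2025ComputingMomentPolytopes, §6.2 and §6.5]
[cite: VergneWalter2014, Prop. 3.13, §6.2 and Tables] -/
theorem vandenBergEtAl2025_unitTensor_four_polytope_maximal_holds :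
    vandenBergEtAl2025_unitTensor_four_polytope_maximal := by
  refine vandenBergEtAl2025_unitTensor_four_polytope_maximal_of_rays (R := ℕ)
    (Finset.range Kron444Hull.nV) (fun r => Kron444Hull.rayW r) ?_ ?_
  · intro n lam hn hg hcard
    exact Kron444Hull.hgen_core Kron444Hull.mem_convexHull_vertices
      (fun h k => Kron444.facets_valid h k)
      (fun hcard' hg' => exists_occurs_of_kroneckerCoeff_pos (N := 4) hcard' hg')
      (by decide +kernel) (fun r hr => Kron444Hull.rayK_pos r hr) lam hn hg hcard
  · intro r hr
    obtain ⟨m, hm, rho, hw, hocc⟩ := Kron444Hull.hocc r (Finset.mem_range.1 hr)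
    exact ⟨m, rho, hm, hw, hocc⟩

end Literature.Computability.AlgebraicComplexity
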